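import Summits.HodgeConjecture.HodgeConjecture.Theorems.SoloInformedUnconditional
import Literature.AlgebraicGeometry.HodgeTheory.SaitoGrFDeRhamCurveNet
import Literature.AlgebraicGeometry.Motives.CurveNetExistenceProofs
import Literature.AlgebraicGeometry.Motives.FiberNetExistence
import Literature.AlgebraicGeometry.Motives.VarietiesProjectiveSpaceProofs
import HarnessLib

/-!
# The Hodge conjecture as a statement about the net of curves every variety carries
(solo seat `solo-HodgeConjecture-informed`, fifth landing)

Every smooth projective complex `X` of dimension `n = m + 1 ≥ 2` carries a CURVE NET
(`Motives.CurveNet m X`, proved to exist in the tree: `Motives.nonempty_curveNet_holds`, the generic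
linear projection): a blow-up `σ : X̃ ⟶ X` of finitely many points and a morphism `π : X̃ ⟶ ℙᵐ` whose
fibres are the curve sections `X ∩ ⟨Λ, b⟩`, smooth projective connected curves over the complement
`U = ℙᵐ ∖ Δ` of the discriminant hypersurface. This file proves, with NO hypothesis (all facts used
are theorems of the tree):

* `soloInformed_curveNetSupport_of_mem_algebraicClasses` — an ALGEBRAIC class `c ∈ H²ᵖ(X̃)` with
  `p ≥ 2` is supported on `π⁻¹V(F)` for a NONZERO admissible form `F` (homogeneous of degree `≥ 1`,
  `Δ ⊆ V(F)`): `c|_{π⁻¹(ℙᵐ ∖ V(F))(ℂ)} = 0`. (A cycle of dimension `m + 1 - p < m` does not dominate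
  the base; `Δ ≠ ℙᵐ` by generic smoothness in characteristic `0`, the tree's
  `FiberNet.discriminant_ne_univ_of_charZero`; proper closed subsets of `ℙᵐ` lie on hypersurfaces.)
* `soloInformed_curveNetSupport_of_hodgeConjecture` — hence, under the Hodge conjecture, every
  rational `(p,p)`-class on the total space of every curve net, `p ≥ 2`, is so supported.
* `soloInformed_hodgeConjecture_iff_curveNetSupport` — **the Hodge conjecture is EQUIVALENT to**:
  for every smooth projective `X` of dimension `m + 1`, every curve net `N` on `X`, every `p` with
  `2 ≤ p`, `2p ≤ m + 1`, and every rational `(p,p)`-class `c` on `X̃ = N.total`, there is a nonzero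
  admissible form `F` with `c` supported on `π⁻¹V(F)`. (`⇐`: such a class has coniveau `≥ 1` on
  `X̃`; `C1` descends along the birational blow-down `σ` —
  `soloInformed_coniveauOne_of_isBirational_target`; and `HodgeConjecture ↔ C1` —
  `soloInformed_hodgeConjecture_iff_coniveauOne'`.)
* `soloInformed_hodgeClasses_algebraic_dim_le_four_iff_curveNetSupport` — **the first open case**:
  the Hodge conjecture for all smooth projective varieties of dimension `≤ 4` holds iff for every
  smooth projective FOURFOLD `X`, every curve net `π : X̃ ⟶ ℙ³` on it and every rational `(2,2)`-class
  `c` on `X̃`, `c|_{π⁻¹(ℙ³ ∖ V(F))(ℂ)} = 0` for some nonzero admissible `F`.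
* `soloInformed_hodgeClasses_algebraic_dim_le_four_iff_rho_eq_zero` — the same in the vocabulary of
  Saito's graded de Rham package of the net (`CurveNetSaitoData`, which exists:
  `curveNetSaitoData_nonempty_holds`): `ρ_F c = 0` in the pure weight-`4` Hodge structure
  `(IH³(ℙ³, j_{!*}R¹π_*ℚ) ⊗ ℂ)/(IH³_{V(F)} ⊗ ℂ)` for some nonzero admissible `F`.

## Reading: where Lefschetz's method stops (solo PLAN, §PATH S3–S4)

Over the affine open `U_F = ℙᵐ ∖ V(F)` the net is a smooth projective family of curves and (Deligne
1968, Leray degenerates; Artin vanishing `H^{m+1}(U_F; ℚ) = 0`) the restriction of a class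
`c ∈ H^{2p}(X̃; ℚ)` to `π⁻¹U_F` has Leray components in `H^{2p}(U_F, ℚ)`, `H^{2p-1}(U_F, R¹π_*ℚ)` and
`H^{2p-2}(U_F, ℚ)(-1)`; the two constant-coefficient components of a weight-`2p` class come from
`H^*(ℙᵐ)` and die after enlarging `F` by a hyperplane. So the theorems above say:

  **HC ⟺ for every net of curves of every `n`-fold and every Hodge class `c` of degree `2p`,
  `4 ≤ 2p ≤ n`, the Leray component `ξ₁(c)` vanishes in `colim_F H^{2p-1}(ℙᵐ ∖ V(F), R¹π_*ℚ)`** —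
  a class in degree `2p - 1 ≥ 3` Galois cohomology of the function field `ℂ(ℙᵐ)` (`cd = m ≥ 2p - 1`)
  with values in the rational Tate module of the Jacobian of the generic curve. For `p = 1` (excluded
  here, and a theorem) `ξ₁(c) ∈ H¹(U, R¹π_*ℤ)` is the class of the NORMAL FUNCTION of `c`, and Jacobi
  inversion realises it by a family of divisors on the curves: Lefschetz's proof of `(1,1)`. For
  `p ≥ 2` the obstruction is a degree-`≥ 3` class of a weight-one variation over a base of dimension
  `≥ 3`; since `H³(U_F ∩ G)` vanishes on every affine surface `G`, "`ξ₁(c)` dies off a hypersurface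
  `G`" is, by purity, "`ξ₁(c)` is the Gysin image of the class of a normal function of the family
  restricted to a smooth surface `G ⊂ U_F`": the jump from `p = 1` to `p = 2` is the existence of
  that surface `G` and that normal function. No inversion theorem is known in this range (Arapura,
  *Hodge cycles and the Leray filtration*, Pacific J. Math. 319 (2022), Thm. 1.2, Rem. 1.3 and
  Cor. 1.4 with `m = 3`, isolates the same group `Hodge(H³(U, R¹f_*ℚ)(2))` for a FIXED fibred
  fourfold; the statements here quantify over the net every fourfold carries and ask only for
  vanishing in the colimit, i.e. base-coniveau `≥ 1`, not for cycles over `U`).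

## References

* [Arapura2022] D. Arapura, Hodge cycles and the Leray filtration, Pacific J. Math. 319 (2022)
  no. 1, 1–20, Thm. 1.2, Rem. 1.3, Cor. 1.4. arXiv:2103.05038.
* [Hartshorne1977] R. Hartshorne, Algebraic Geometry (1977), II Ex. 7.17.3, II Thm. 8.18,
  III Cor. 10.7.
* [VoisinHodgeII2003] C. Voisin, Hodge Theory and Complex Algebraic Geometry II (2003), §2.3.1,
  Ch. 8 (normal functions).
* [GrothendieckTopology1969] A. Grothendieck, Hodge's general conjecture is false for trivial
  reasons, Topology 8 (1969), §1.
* [Saito1990] M. Saito, Mixed Hodge modules, Publ. RIMS 26 (1990), Thm. 0.1–0.2.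
* [Deligne2000] P. Deligne, The Hodge conjecture, Clay Mathematics Institute (2000), §1.
-/

noncomputable section

open CategoryTheory AlgebraicGeometry
open Literature.AlgebraicTopology.SingularHomology
open Literature.AlgebraicGeometry Literature.AlgebraicGeometry.HodgeTheory
open Literature.AlgebraicGeometry.Motives (CurveNet nonempty_curveNet_holds
  isSmoothProjective_projectiveSpace_holds)

namespace Summit.HodgeConjecture.HodgeConjecture.Theorems

variable {m : ℕ} {X : Motives.SchemeOver ℂ}

/-! ### Necessity: algebraic classes of codimension `≥ 2` are supported over hypersurfaces of the base -/

/-- **Algebraic classes of codimension `p ≥ 2` on the total space of a curve net are supported on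
the preimage of a nonzero admissible hypersurface.** For `N : CurveNet m X` over `ℂ` and
`c ∈ Nᵖ H²ᵖ(X̃(ℂ); ℂ)` with `2 ≤ p`, there is a form `F ≠ 0`, homogeneous of degree `≥ 1` with
`Δ ⊆ V(F)`, such that `c` restricts to zero on the complex points of `X̃ ∖ π⁻¹V(F)`. Proof: `c` dies
off `π⁻¹T` for a proper closed `T ⊊ ℙᵐ` (`soloInformed_verticalSupport_of_mem_algebraicClasses`:
`dim X̃ = m + 1 < m + p`); `T ⊆ V(G)` for a nonzero form `G` (`exists_form_of_isClosed_of_ne_univ`);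
`Δ ≠ ℙᵐ` in characteristic `0` (`FiberNet.discriminant_ne_univ_of_charZero`) gives a nonzero
admissible `F₁` (`CurveNet.exists_isAdmissibleForm_ne_zero`); take `F = F₁ · G`.
[cite: Hartshorne1977, II Ex. 3.22 and III Cor. 10.7] [cite: Arapura2022, §1] -/
theorem soloInformed_curveNetSupport_of_mem_algebraicClasses (N : CurveNet m X) {p : ℕ}
    (hp : 2 ≤ p) {c : complexBetti N.total (2 * p)} (hc : c ∈ algebraicClasses N.total p) :
    ∃ F : MvPolynomial (Fin (m + 1)) ℂ, N.IsAdmissibleForm F ∧ F ≠ 0 ∧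
      c ∈ classesSupportedOn N.total (N.proj.left.base ⁻¹' projHypersurface m F) (2 * p) := by
  -- vertical support over a proper closed `T ⊊ ℙᵐ`
  obtain ⟨T, hT, hTne, hcT⟩ := soloInformed_verticalSupport_of_mem_algebraicClasses
    N.isSmoothProjective_total (isSmoothProjective_projectiveSpace_holds ℂ m) N.proj
    (p := p) (by omega) hc
  -- `T ⊆ V(G)`, `G ≠ 0` a form of degree `≥ 1`
  obtain ⟨G, e, -, hGe, hG0, hTG⟩ := exists_form_of_isClosed_of_ne_univ m hT hTne
  -- a nonzero admissible form `F₁` (`Δ ≠ ℙᵐ` by generic smoothness in characteristic `0`)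
  have hΔ : N.discriminant ≠ Set.univ := N.toFiberNet.discriminant_ne_univ_of_charZero
  obtain ⟨F₁, hF₁, hF₁0⟩ := N.exists_isAdmissibleForm_ne_zero hΔ
  refine ⟨F₁ * G, N.isAdmissibleForm_mul hF₁ hGe, mul_ne_zero hF₁0 hG0, ?_⟩
  -- `π⁻¹T ⊆ π⁻¹V(G) ⊆ π⁻¹V(F₁ G)`
  have hsub : N.proj.left.base ⁻¹' T ⊆ N.proj.left.base ⁻¹' projHypersurface m (F₁ * G) := by
    refine Set.preimage_mono (hTG.trans ?_)
    rw [mul_comm]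
    exact projHypersurface_subset_mul m G F₁
  exact classesSupportedOn_mono hsub (2 * p) (mem_classesSupportedOn_iff.mpr hcT)

/-- **Under the Hodge conjecture every rational `(p,p)`-class (`p ≥ 2`) on the total space of every
curve net is supported on the preimage of a nonzero admissible hypersurface of `ℙᵐ`.**
[cite: Hartshorne1977, II Ex. 3.22] [cite: Arapura2022, §1] [cite: Deligne2000, §1] -/
theorem soloInformed_curveNetSupport_of_hodgeConjecture (h : _root_.HodgeConjecture)
    (N : CurveNet m X) {p : ℕ} (hp : 2 ≤ p) (c : complexBetti N.total (2 * p))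
    (hc : IsRationalClass c) (hc' : IsOfHodgeType (m + 1) N.total (2 * p) p p c) :
    ∃ F : MvPolynomial (Fin (m + 1)) ℂ, N.IsAdmissibleForm F ∧ F ≠ 0 ∧
      c ∈ classesSupportedOn N.total (N.proj.left.base ⁻¹' projHypersurface m F) (2 * p) :=
  soloInformed_curveNetSupport_of_mem_algebraicClasses N hp
    ((h N.isSmoothProjective_total).2 p c hc hc')

/-! ### Sufficiency: support over hypersurfaces on `X̃` gives coniveau `≥ 1` on `X` -/

/-- **Curve-net support on `X̃` gives `C1` on `X`.** Let `X` be smooth projective of dimension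
`m + 1` with a curve net `N` (`σ : X̃ ⟶ X`, `π : X̃ ⟶ ℙᵐ`). If every rational `(p,p)`-class on `X̃` is
supported on `π⁻¹V(F)` for some nonzero admissible `F`, then every rational `(p,p)`-class on `X`
has coniveau `≥ 1`. Proof: `π` is surjective and `V(F) ⊊ ℙᵐ` is closed, so such a class has
coniveau `≥ 1` on `X̃` (`soloInformed_coniveauOne_of_verticalSupport`); `σ` is birational in the
sense of `Resolution.IsBirational` (an isomorphism over the dense open `X ∖ F`, whose preimage is a
non-empty open of the irreducible `X̃`), and `C1` descends along birational morphisms of smooth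
projective varieties (`soloInformed_coniveauOne_of_isBirational_target`: `c = σ_* σ^* c` and Gysin
maps preserve coniveau), with the discharged facts `gysinMap_restrictCompl_eq_zero_of_field ℂ`,
`hodgePQ_independent_of_hodgeModel_holds`, `nonempty_hodgeModel_holds`.
[cite: GrothendieckTopology1969, §1] [cite: Hartshorne1977, II Example 7.17.3] -/
theorem soloInformed_coniveauOne_of_curveNetSupport (hX : Motives.IsSmoothProjective (m + 1) X)
    (N : CurveNet m X) {p : ℕ}
    (h : ∀ z : complexBetti N.total (2 * p), IsRationalClass z →
      IsOfHodgeType (m + 1) N.total (2 * p) p p z →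
      ∃ F : MvPolynomial (Fin (m + 1)) ℂ, N.IsAdmissibleForm F ∧ F ≠ 0 ∧
        z ∈ classesSupportedOn N.total (N.proj.left.base ⁻¹' projHypersurface m F) (2 * p))
    (c : complexBetti X (2 * p)) (hc : IsRationalClass c) (hc' : IsOfHodgeType (m + 1) X (2 * p) p p c) :
    c ∈ supportedClasses X (2 * p) 1 := by
  -- `C1(m + 1, p)` on the total space `X̃`
  have hC : ∀ z : complexBetti N.total (2 * p), IsRationalClass z →
      IsOfHodgeType (m + 1) N.total (2 * p) p p z → z ∈ supportedClasses N.total (2 * p) 1 := by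
    intro z hz hz'
    obtain ⟨F, -, hF0, hzF⟩ := h z hz hz'
    exact soloInformed_coniveauOne_of_verticalSupport N.isSmoothProjective_total N.proj
      N.surjective_proj (isClosed_projHypersurface m F) (projHypersurface_ne_univ m hF0)
      (mem_classesSupportedOn_iff.mp hzF)
  -- the blow-down `σ : X̃ ⟶ X` is birational
  have hbir : Resolution.IsBirational N.blowDown.left := by
    haveI := irreducibleSpace_of_isSmoothProjective' hX
    haveI := N.irreducibleSpace_total
    refine ⟨N.offBaseLocus, N.offBaseLocus.isOpen.dense N.offBaseLocus_nonempty, ?_,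
      N.isIso_blowDown_morphismRestrict⟩
    obtain ⟨x, hx⟩ := N.offBaseLocus_nonempty
    obtain ⟨y, hy⟩ := N.compl_baseLocus_subset_range_blowDown hx
    refine (N.blowDown.left ⁻¹ᵁ N.offBaseLocus).isOpen.dense ⟨y, ?_⟩
    show N.blowDown.left.base y ∈ (N.offBaseLocus : Set X.left)
    rw [hy]
    exact hx
  -- descend along `σ`
  exact soloInformed_coniveauOne_of_isBirational_target (gysinMap_restrictCompl_eq_zero_of_field ℂ)
    hodgePQ_independent_of_hodgeModel_holds (fun _ _ ↦ nonempty_hodgeModel_holds)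
    N.isSmoothProjective_total hX N.blowDown hbir hC c hc hc'

/-- **The Hodge conjecture is equivalent to its curve-net form.** `HodgeConjecture ↔` for every
smooth projective complex `X` of dimension `m + 1`, every curve net `N` on `X` (total space
`X̃ = N.total`, net map `π : X̃ ⟶ ℙᵐ`), every `p` with `2 ≤ p` and `2p ≤ m + 1`, and every rational
class `c ∈ H²ᵖ(X̃(ℂ); ℂ)` of Hodge type `(p,p)`, there is a nonzero admissible form `F` (homogeneous of
degree `≥ 1`, `Δ ⊆ V(F)`) with `c|_{(X̃ ∖ π⁻¹V(F))(ℂ)} = 0`. `⇒`: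
`soloInformed_curveNetSupport_of_hodgeConjecture`. `⇐`: a variety of dimension `n ≥ 4` is `X` with
`n = m + 1`; it carries a curve net (`Motives.nonempty_curveNet_holds`); the hypothesis gives `C1`
on `X̃`, which descends to `X` along the birational `σ`
(`soloInformed_coniveauOne_of_curveNetSupport`); and `HodgeConjecture ↔ C1`
(`soloInformed_hodgeConjecture_iff_coniveauOne'`).
[cite: Arapura2022, Thm. 1.2, Rem. 1.3, Cor. 1.4] [cite: GrothendieckTopology1969, pp. 300–301]
[cite: Hartshorne1977, II Example 7.17.3] [cite: Deligne2000, §1] -/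
theorem soloInformed_hodgeConjecture_iff_curveNetSupport :
    _root_.HodgeConjecture ↔
      ∀ ⦃m : ℕ⦄ ⦃X : Motives.SchemeOver ℂ⦄, Motives.IsSmoothProjective (m + 1) X →
        ∀ (N : CurveNet m X) (p : ℕ) (c : complexBetti N.total (2 * p)), 2 ≤ p → 2 * p ≤ m + 1 →
          IsRationalClass c → IsOfHodgeType (m + 1) N.total (2 * p) p p c →
          ∃ F : MvPolynomial (Fin (m + 1)) ℂ, N.IsAdmissibleForm F ∧ F ≠ 0 ∧
            c ∈ classesSupportedOn N.total (N.proj.left.base ⁻¹' projHypersurface m F) (2 * p) := by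
  refine ⟨fun h m X _ N p c hp _ hc hc' ↦ soloInformed_curveNetSupport_of_hodgeConjecture h N hp c hc hc',
    fun h ↦ soloInformed_hodgeConjecture_iff_coniveauOne'.mpr fun n X hX p c hp hpn hc hc' ↦ ?_⟩
  -- `n ≥ 4`, so `n = m + 1` with `1 ≤ m`, and `X` carries a curve net
  obtain ⟨m, rfl⟩ : ∃ m, n = m + 1 := ⟨n - 1, by omega⟩
  obtain ⟨N⟩ := nonempty_curveNet_holds hX (by omega)
  exact soloInformed_coniveauOne_of_curveNetSupport hX N (fun z hz hz' ↦ h hX N p z hp hpn hz hz')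
    c hc hc'

/-! ### The first open case `(n, p) = (4, 2)`: nets of curves on fourfolds over `ℙ³` -/

/-- **The Hodge conjecture in dimension `≤ 4` as a statement about nets of curves on fourfolds.**
The Hodge conjecture (cycle part) for all smooth projective complex varieties of dimension `≤ 4`
holds iff for every smooth projective fourfold `X`, every curve net `π : X̃ ⟶ ℙ³` on it and every
rational `(2,2)`-class `c` on `X̃`, `c|_{(X̃ ∖ π⁻¹V(F))(ℂ)} = 0` for some nonzero admissible form `F`
(equivalently: the Leray component of `c` in `colim_F H³(ℙ³ ∖ V(F), R¹π_*ℚ)` vanishes).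
[cite: Arapura2022, Cor. 1.4] [cite: GrothendieckTopology1969, pp. 300–301] [cite: Deligne2000, §1] -/
theorem soloInformed_hodgeClasses_algebraic_dim_le_four_iff_curveNetSupport :
    (∀ ⦃n : ℕ⦄ ⦃X : Motives.SchemeOver ℂ⦄, n ≤ 4 → Motives.IsSmoothProjective n X →
        ∀ (p : ℕ) (c : complexBetti X (2 * p)), IsRationalClass c →
          IsOfHodgeType n X (2 * p) p p c → c ∈ algebraicClasses X p) ↔
      ∀ ⦃X : Motives.SchemeOver ℂ⦄, Motives.IsSmoothProjective 4 X →
        ∀ (N : CurveNet 3 X) (c : complexBetti N.total (2 * 2)), IsRationalClass c →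
          IsOfHodgeType 4 N.total (2 * 2) 2 2 c →
          ∃ F : MvPolynomial (Fin (3 + 1)) ℂ, N.IsAdmissibleForm F ∧ F ≠ 0 ∧
            c ∈ classesSupportedOn N.total (N.proj.left.base ⁻¹' projHypersurface 3 F) (2 * 2) := by
  refine ⟨fun h X _ N c hc hc' ↦ soloInformed_curveNetSupport_of_mem_algebraicClasses N le_rfl
      (h le_rfl N.isSmoothProjective_total 2 c hc hc'),
    fun h ↦ soloInformed_hodgeClasses_algebraic_dim_le_four_iff_coniveauOne_two_two'.mpr
      fun X hX c hc hc' ↦ ?_⟩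
  obtain ⟨N⟩ := nonempty_curveNet_holds hX (by norm_num)
  exact soloInformed_coniveauOne_of_curveNetSupport hX N (fun z hz hz' ↦ h hX N z hz hz') c hc hc'

/-- **The same in Saito's vocabulary.** The Hodge conjecture in dimension `≤ 4` holds iff for every
smooth projective fourfold `X`, every curve net `N` on it, every graded de Rham package
`K : CurveNetSaitoData N` (one exists: `curveNetSaitoData_nonempty_holds`) and every rational
`(2,2)`-class `c` on `X̃`, the image `ρ_F c` of `c` in the pure weight-`4` Hodge structure
`(IH³(ℙ³, j_{!*}R¹π_*ℚ) ⊗ ℂ)/(IH³_{V(F)} ⊗ ℂ)` vanishes for some nonzero admissible `F`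
(`CurveNetSaitoData.rho_eq_zero_iff`: `ρ_F c = 0` iff `c` is supported on `π⁻¹V(F)`).
[cite: Saito1990, Thm. 0.1–0.2] [cite: Arapura2022, Cor. 1.4] [cite: Deligne2000, §1] -/
theorem soloInformed_hodgeClasses_algebraic_dim_le_four_iff_rho_eq_zero :
    (∀ ⦃n : ℕ⦄ ⦃X : Motives.SchemeOver ℂ⦄, n ≤ 4 → Motives.IsSmoothProjective n X →
        ∀ (p : ℕ) (c : complexBetti X (2 * p)), IsRationalClass c →
          IsOfHodgeType n X (2 * p) p p c → c ∈ algebraicClasses X p) ↔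
      ∀ ⦃X : Motives.SchemeOver ℂ⦄, Motives.IsSmoothProjective 4 X →
        ∀ (N : CurveNet 3 X) (K : CurveNetSaitoData N) (c : complexBetti N.total (3 + 1)),
          IsRationalClass c → IsOfHodgeType 4 N.total (2 * 2) 2 2 c →
          ∃ F : MvPolynomial (Fin (3 + 1)) ℂ, N.IsAdmissibleForm F ∧ F ≠ 0 ∧ K.rho F c = 0 := by
  rw [soloInformed_hodgeClasses_algebraic_dim_le_four_iff_curveNetSupport]
  refine ⟨fun h X hX N K c hc hc' ↦ ?_, fun h X hX N c hc hc' ↦ ?_⟩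
  · obtain ⟨F, hF, hF0, hcF⟩ := h hX N c hc hc'
    exact ⟨F, hF, hF0, (K.rho_eq_zero_iff hF c).mpr hcF⟩
  · obtain ⟨K⟩ := curveNetSaitoData_nonempty_holds N (by norm_num)
    obtain ⟨F, hF, hF0, hcF⟩ := h hX N K c hc hc'
    exact ⟨F, hF, hF0, (K.rho_eq_zero_iff hF c).mp hcF⟩

end Summit.HodgeConjecture.HodgeConjecture.Theorems

end
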